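import Summits.Ventures.LatticeQCDFlow.Scaling.PlaquetteCorrelatorRP

/-!
HONEST FRAMING: exact (Metropolis-corrected) sampling algorithms for lattice gauge theory; figures
of merit are autocorrelation/cost numbers at stated couplings and volumes; no continuum-physics
claim.

# PlaquetteCorrelatorLogConvex — REFLECTION POSITIVITY MAKES THE TEMPORAL CORRELATOR OF A SPATIAL
# PLAQUETTE LOG-CONVEX IN THE SEPARATION, ON EVERY TORUS (lean-1 GEN-11, ours; part 2 of 3 of the
# strong-coupling clustering floor (U″))

Venture-side (OURS). Cell `lqcd-flow` (pub-lqcd), unit `pub-lqcd-lean-1-g11`, 2026-08-23.  With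
`g(m) = ⟨P_0 P_m⟩ − ⟨P_0⟩⟨P_m⟩` the truncated temporal correlator of a spatial plaquette
(`PlaquetteCorrelatorRP.tCorr`, base site of time `0`, orientation `i, j ≠ 0`), the three
Osterwalder–Seiler reflection positivities of the tree and the Schwarz inequality of the reflection
form (Literature `FariaDaVeigaOCarroll2022.MultiReflection.sq_integral_mul_comp_le_of_rp`) give:

* **`g(s+t−1)² ≤ g(2t−1)·g(2s−1)`** for `1 ≤ s, t ≤ L/2`, `L` even, `β ≥ 0` (link reflection
  `t ↦ 1 − t`, `sq_corr_le_link`) and for `1 ≤ s, t ≤ L/2 + 1`, `L ≥ 3` odd, `β ≥ 0` (the mixed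
  reflection of the odd torus, `sq_corr_le_odd`);
* **`g(s+t)² ≤ g(2t)·g(2s)`** for `0 ≤ s, t ≤ L/2`, `L` even, every real `β` (site reflection
  `t ↦ −t`, `sq_corr_le_site`);
* **`0 ≤ g(1)`** for every `L ≥ 2`, `β ≥ 0` (`corr_one_nonneg`).

Hence `g(n)² ≤ g(n−1)·g(n+1)` for all `1 ≤ n ≤ L − 2` on every torus with `L ≥ 3` (by parity: even
`n` from the link forms, odd `n` from the site form on even tori and from `g(n) = g(L − n)` on odd
tori) — the sequel `ClusteringFloorStrongCoupling` turns this and `g(1) ≥ δ > 0` ((U′) at strong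
coupling) into the clustering floor `g(n) ≥ δ (δ/2N²)^n`.

NOT CLAIMED: temporal plaquettes; separations in a spatial direction; `β < 0`.  Literature grade
(cell rule): known mechanism (reflection positivity ⇒ Schwarz inequality ⇒ log-convexity of two-point
functions in the reflected direction; Seiler LNP 159 Ch. 2, Glimm–Jaffe §6, Fröhlich–Israel–Lieb–Simon
1978); new typing on finite tori of both parities, no new theorem of physics.
-/

noncomputable section

namespace Summit.Ventures.LatticeQCDFlow.Theory2.Clustering

open MeasureTheory Literature.MathematicalPhysics.QuantumFieldTheory
open Literature.MathematicalPhysics.QuantumFieldTheory.FariaDaVeigaOCarroll2022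
open Literature.MathematicalPhysics.QuantumFieldTheory.FariaDaVeigaOCarroll2022.MultiReflection

section RP

variable {d L N : ℕ} [NeZero d] [NeZero L] {G : Type*} [Group G] [TopologicalSpace G]
  [IsTopologicalGroup G] [CompactSpace G] [MeasurableSpace G] [BorelSpace G]
  [SecondCountableTopology G] (ρ : G →* Matrix (Fin N) (Fin N) ℂ)

/-- **LINK REFLECTION, EVEN TORUS**: for `β ≥ 0`, a time-zero base site `x` (`x 0 = 0`), a spatial
orientation `i, j ≠ 0` and `1 ≤ s, t ≤ L/2`:
`g(s + t − 1)² ≤ g(2t − 1) · g(2s − 1)`. -/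
theorem sq_corr_le_link (hL : Even L) (hρ : Continuous ρ) {β : ℝ} (hβ : 0 ≤ β) {x : Site d L}
    (hx : x 0 = 0) {i j : Fin d} (hi : i ≠ 0) (hj : j ≠ 0) {s t : ℕ} (hs1 : 1 ≤ s)
    (hs : s ≤ L / 2) (ht1 : 1 ≤ t) (ht : t ≤ L / 2) :
    (tCorr ρ β x i j (((s + t - 1 : ℕ) : ZMod L))) ^ 2
      ≤ tCorr ρ β x i j (((2 * t - 1 : ℕ) : ZMod L)) * tCorr ρ β x i j (((2 * s - 1 : ℕ) : ZMod L)) := by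
  haveI := isProbabilityMeasure_wilsonMeasure (d := d) (L := L) ρ hρ β
  haveI : Fact (1 < L) := ⟨by obtain ⟨r, hr⟩ := hL; have := NeZero.ne L; omega⟩
  set c := wilsonExpectation ρ β (tObs ρ x i j 0) with hc
  -- the admissible class: observables of the positive-time links
  have hadm : ∀ (A B : GaugeConfig d L G → ℝ) (r : ℝ), DependsOn A {e : Edge d L | WilsonRP.IsPosEdge e} →
      DependsOn B {e : Edge d L | WilsonRP.IsPosEdge e} →
      DependsOn (fun U => A U + r * B U) {e : Edge d L | WilsonRP.IsPosEdge e} :=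
    fun A B r hA hB U V hUV => by simp only [hA hUV, hB hUV]
  -- support of `P_m − c` for `1 ≤ m ≤ L/2`
  have hsupp : ∀ m : ℕ, 1 ≤ m → m ≤ L / 2 →
      DependsOn (fun U : GaugeConfig d L G => tObs ρ x i j (m : ZMod L) U - c)
        {e : Edge d L | WilsonRP.IsPosEdge e} := by
    intro m hm1 hm U V hUV
    refine (centred_Pobs_props ρ hρ x hi hj (m : ZMod L) c).2.2 fun e he => hUV e ?_
    obtain ⟨he2, he1⟩ := he
    have hval : (e.1 0).val = m := by
      rw [he1, add_single_apply_zero hx, ZMod.val_natCast, Nat.mod_eq_of_lt (by omega)]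
    have hval' : ((e.1.shift e.2) 0).val = m := by rw [shift_apply_zero_of_ne e.1 he2, hval]
    show 1 ≤ (e.1 0).val ∧ (e.1 0).val ≤ L / 2 ∧ 1 ≤ ((e.1.shift e.2) 0).val ∧
      ((e.1.shift e.2) 0).val ≤ L / 2
    rw [hval, hval']
    exact ⟨hm1, hm, hm1, hm⟩
  obtain ⟨hAm, hAb, -⟩ := centred_Pobs_props ρ hρ x hi hj ((t : ℕ) : ZMod L) c
  obtain ⟨hBm, hBb, -⟩ := centred_Pobs_props ρ hρ x hi hj ((s : ℕ) : ZMod L) c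
  have key := sq_integral_mul_comp_le_of_rp (μ := wilsonMeasure ρ β) timeReflectEquiv
    (measurePreserving_timeReflectEquiv ρ hρ β)
    (fun U => (timeReflectEquiv (d := d) (L := L) (G := G)).left_inv U)
    (fun F => DependsOn F {e : Edge d L | WilsonRP.IsPosEdge e}) hadm
    (fun F hF hFm hFb => integral_mul_timeReflect_nonneg ρ hL hρ hβ hFm hFb hF)
    (hsupp t ht1 ht) (hsupp s hs1 hs) hAm hBm hAb hBb
  -- identify the three integrals
  have happ : ∀ U : GaugeConfig d L G,
      (timeReflectEquiv : GaugeConfig d L G ≃ᵐ GaugeConfig d L G) U = U.timeReflect := fun U => rfl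
  have hts : ∀ (U : GaugeConfig d L G) (y : Site d L),
      plaquetteHolonomy U.timeReflect y i j = plaquetteHolonomy U y.timeReflect i j := fun U y => by
    simp only [plaquetteHolonomy, GaugeConfig.timeReflect, hi, hj, if_false,
      WilsonRP.timeReflect_shift_of_ne _ hi, WilsonRP.timeReflect_shift_of_ne _ hj]
  have hrefl : ∀ (m : ZMod L) (U : GaugeConfig d L G),
      tObs ρ x i j m (timeReflectEquiv U) = tObs ρ x i j (1 - m) U := by
    intro m U
    rw [happ]
    unfold tObs
    rw [hts U _, timeReflect_add_single hx]
  have hI : ∀ m m' : ZMod L,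
      ∫ U, (tObs ρ x i j m U - c) * (tObs ρ x i j m' (timeReflectEquiv U) - c) ∂(wilsonMeasure ρ β)
        = tCorr ρ β x i j (1 - m' - m) := by
    intro m m'
    simp_rw [hrefl]
    rw [integral_centred_Pobs ρ hρ β x i j m (1 - m')]
  rw [hI, hI, hI] at key
  have e1 : (1 : ZMod L) - ((s : ℕ) : ZMod L) - ((t : ℕ) : ZMod L) = -(((s + t - 1 : ℕ) : ZMod L)) := by
    have : 1 ≤ s + t := by omega
    push_cast [Nat.cast_sub this]
    ring
  have e2 : (1 : ZMod L) - ((t : ℕ) : ZMod L) - ((t : ℕ) : ZMod L) = -(((2 * t - 1 : ℕ) : ZMod L)) := by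
    have : 1 ≤ 2 * t := by omega
    push_cast [Nat.cast_sub this]
    ring
  have e3 : (1 : ZMod L) - ((s : ℕ) : ZMod L) - ((s : ℕ) : ZMod L) = -(((2 * s - 1 : ℕ) : ZMod L)) := by
    have : 1 ≤ 2 * s := by omega
    push_cast [Nat.cast_sub this]
    ring
  rw [e1, e2, e3, corr_neg, corr_neg, corr_neg] at key
  exact key

/-- **LINK REFLECTION, ODD TORUS**: for `L` odd, `L ≥ 3`, `β ≥ 0`, a time-zero base site, a spatial
orientation and `1 ≤ s, t ≤ L/2 + 1` (the closed half up to the site hyperplane):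
`g(s + t − 1)² ≤ g(2t − 1) · g(2s − 1)`. -/
theorem sq_corr_le_odd (hL : Odd L) (hL3 : 3 ≤ L) (hρ : Continuous ρ) {β : ℝ} (hβ : 0 ≤ β)
    {x : Site d L} (hx : x 0 = 0) {i j : Fin d} (hi : i ≠ 0) (hj : j ≠ 0) {s t : ℕ} (hs1 : 1 ≤ s)
    (hs : s ≤ L / 2 + 1) (ht1 : 1 ≤ t) (ht : t ≤ L / 2 + 1) :
    (tCorr ρ β x i j (((s + t - 1 : ℕ) : ZMod L))) ^ 2
      ≤ tCorr ρ β x i j (((2 * t - 1 : ℕ) : ZMod L)) * tCorr ρ β x i j (((2 * s - 1 : ℕ) : ZMod L)) := by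
  haveI := isProbabilityMeasure_wilsonMeasure (d := d) (L := L) ρ hρ β
  haveI : Fact (1 < L) := ⟨by omega⟩
  set c := wilsonExpectation ρ β (tObs ρ x i j 0) with hc
  set adm : (GaugeConfig d L G → ℝ) → Prop := fun F => DependsOn F
    ((WilsonOddRP.oPosEdges ∪ WilsonOddRP.oSharedEdges : Finset (Edge d L)) : Set (Edge d L)) with hadm_def
  have hadm : ∀ (A B : GaugeConfig d L G → ℝ) (r : ℝ), adm A → adm B → adm (fun U => A U + r * B U) :=
    fun A B r hA hB U V hUV => by simp only [hA hUV, hB hUV]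
  have hsupp : ∀ m : ℕ, 1 ≤ m → m ≤ L / 2 + 1 →
      adm (fun U : GaugeConfig d L G => tObs ρ x i j (m : ZMod L) U - c) := by
    intro m hm1 hm U V hUV
    refine (centred_Pobs_props ρ hρ x hi hj (m : ZMod L) c).2.2 fun e he => hUV e ?_
    obtain ⟨he2, he1⟩ := he
    have hval : (e.1 0).val = m := by
      rw [he1, add_single_apply_zero hx, ZMod.val_natCast, Nat.mod_eq_of_lt (by omega)]
    rw [Finset.coe_union, Set.mem_union, Finset.mem_coe, Finset.mem_coe, WilsonOddRP.mem_oPosEdges,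
      WilsonOddRP.mem_oSharedEdges]
    rcases Nat.lt_or_ge m (L / 2 + 1) with hlt | hge
    · left
      show 1 ≤ (e.1 0).val ∧ (e.1 0).val ≤ L / 2
      rw [hval]; exact ⟨hm1, by omega⟩
    · right
      show e.2 ≠ 0 ∧ (e.1 0).val = L / 2 + 1
      rw [hval]; exact ⟨he2, by omega⟩
  obtain ⟨hAm, hAb, -⟩ := centred_Pobs_props ρ hρ x hi hj ((t : ℕ) : ZMod L) c
  obtain ⟨hBm, hBb, -⟩ := centred_Pobs_props ρ hρ x hi hj ((s : ℕ) : ZMod L) c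
  have key := sq_integral_mul_comp_le_of_rp (μ := wilsonMeasure ρ β) timeReflectEquiv
    (measurePreserving_timeReflectEquiv ρ hρ β)
    (fun U => (timeReflectEquiv (d := d) (L := L) (G := G)).left_inv U)
    adm hadm
    (fun F hF hFm hFb => integral_mul_timeReflect_nonneg_odd ρ hL hL3 hρ hβ hFm hFb hF)
    (hsupp t ht1 ht) (hsupp s hs1 hs) hAm hBm hAb hBb
  have happ : ∀ U : GaugeConfig d L G,
      (timeReflectEquiv : GaugeConfig d L G ≃ᵐ GaugeConfig d L G) U = U.timeReflect := fun U => rfl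
  have hts : ∀ (U : GaugeConfig d L G) (y : Site d L),
      plaquetteHolonomy U.timeReflect y i j = plaquetteHolonomy U y.timeReflect i j := fun U y => by
    simp only [plaquetteHolonomy, GaugeConfig.timeReflect, hi, hj, if_false,
      WilsonRP.timeReflect_shift_of_ne _ hi, WilsonRP.timeReflect_shift_of_ne _ hj]
  have hrefl : ∀ (m : ZMod L) (U : GaugeConfig d L G),
      tObs ρ x i j m (timeReflectEquiv U) = tObs ρ x i j (1 - m) U := by
    intro m U
    rw [happ]
    unfold tObs
    rw [hts U _, timeReflect_add_single hx]
  have hI : ∀ m m' : ZMod L,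
      ∫ U, (tObs ρ x i j m U - c) * (tObs ρ x i j m' (timeReflectEquiv U) - c) ∂(wilsonMeasure ρ β)
        = tCorr ρ β x i j (1 - m' - m) := by
    intro m m'
    simp_rw [hrefl]
    rw [integral_centred_Pobs ρ hρ β x i j m (1 - m')]
  rw [hI, hI, hI] at key
  have e1 : (1 : ZMod L) - ((s : ℕ) : ZMod L) - ((t : ℕ) : ZMod L) = -(((s + t - 1 : ℕ) : ZMod L)) := by
    have : 1 ≤ s + t := by omega
    push_cast [Nat.cast_sub this]
    ring
  have e2 : (1 : ZMod L) - ((t : ℕ) : ZMod L) - ((t : ℕ) : ZMod L) = -(((2 * t - 1 : ℕ) : ZMod L)) := by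
    have : 1 ≤ 2 * t := by omega
    push_cast [Nat.cast_sub this]
    ring
  have e3 : (1 : ZMod L) - ((s : ℕ) : ZMod L) - ((s : ℕ) : ZMod L) = -(((2 * s - 1 : ℕ) : ZMod L)) := by
    have : 1 ≤ 2 * s := by omega
    push_cast [Nat.cast_sub this]
    ring
  rw [e1, e2, e3, corr_neg, corr_neg, corr_neg] at key
  exact key

/-- **SITE REFLECTION, EVEN TORUS**: for ANY real `β`, a time-zero base site, a spatial orientation
and `0 ≤ s, t ≤ L/2`: `g(s + t)² ≤ g(2t) · g(2s)`. -/
theorem sq_corr_le_site (hL : Even L) (hρ : Continuous ρ) (β : ℝ) {x : Site d L} (hx : x 0 = 0)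
    {i j : Fin d} (hi : i ≠ 0) (hj : j ≠ 0) {s t : ℕ} (hs : s ≤ L / 2) (ht : t ≤ L / 2) :
    (tCorr ρ β x i j (((s + t : ℕ) : ZMod L))) ^ 2
      ≤ tCorr ρ β x i j (((2 * t : ℕ) : ZMod L)) * tCorr ρ β x i j (((2 * s : ℕ) : ZMod L)) := by
  haveI := isProbabilityMeasure_wilsonMeasure (d := d) (L := L) ρ hρ β
  haveI : Fact (1 < L) := ⟨by obtain ⟨r, hr⟩ := hL; have := NeZero.ne L; omega⟩
  set c := wilsonExpectation ρ β (tObs ρ x i j 0) with hc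
  set adm : (GaugeConfig d L G → ℝ) → Prop := fun F => DependsOn F
    ((WilsonSiteRP.sitePosEdges ∪ WilsonSiteRP.sharedEdges : Finset (Edge d L)) : Set (Edge d L))
    with hadm_def
  have hadm : ∀ (A B : GaugeConfig d L G → ℝ) (r : ℝ), adm A → adm B → adm (fun U => A U + r * B U) :=
    fun A B r hA hB U V hUV => by simp only [hA hUV, hB hUV]
  have hL1 : 1 < L := Fact.out
  have hsupp : ∀ m : ℕ, m ≤ L / 2 →
      adm (fun U : GaugeConfig d L G => tObs ρ x i j (m : ZMod L) U - c) := by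
    intro m hm U V hUV
    refine (centred_Pobs_props ρ hρ x hi hj (m : ZMod L) c).2.2 fun e he => hUV e ?_
    obtain ⟨he2, he1⟩ := he
    have hval : (e.1 0).val = m := by
      rw [he1, add_single_apply_zero hx, ZMod.val_natCast, Nat.mod_eq_of_lt (by omega)]
    rw [Finset.coe_union, Set.mem_union, Finset.mem_coe, Finset.mem_coe, WilsonSiteRP.mem_sitePosEdges,
      WilsonSiteRP.mem_sharedEdges]
    by_cases h0 : m = 0
    · right
      show e.2 ≠ 0 ∧ ((e.1 0).val = 0 ∨ (e.1 0).val = L / 2)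
      rw [hval]; exact ⟨he2, Or.inl h0⟩
    · by_cases hL2 : m = L / 2
      · right
        show e.2 ≠ 0 ∧ ((e.1 0).val = 0 ∨ (e.1 0).val = L / 2)
        rw [hval]; exact ⟨he2, Or.inr hL2⟩
      · left
        show (if e.2 = 0 then (e.1 0).val < L / 2 else 1 ≤ (e.1 0).val ∧ (e.1 0).val < L / 2)
        rw [if_neg he2, hval]
        exact ⟨by omega, by omega⟩
  obtain ⟨hAm, hAb, -⟩ := centred_Pobs_props ρ hρ x hi hj ((t : ℕ) : ZMod L) c
  obtain ⟨hBm, hBb, -⟩ := centred_Pobs_props ρ hρ x hi hj ((s : ℕ) : ZMod L) c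
  have key := sq_integral_mul_comp_le_of_rp (μ := wilsonMeasure ρ β) WilsonSiteRP.negReflectEquiv
    (measurePreserving_negReflectEquiv ρ hL hρ β)
    (fun U => (WilsonSiteRP.negReflectEquiv (d := d) (L := L) (G := G)).left_inv U)
    adm hadm
    (fun F hF hFm hFb => integral_mul_negReflect_nonneg ρ hL hρ β hFm hFb hF)
    (hsupp t ht) (hsupp s hs) hAm hBm hAb hBb
  have happ : ∀ U : GaugeConfig d L G,
      (WilsonSiteRP.negReflectEquiv : GaugeConfig d L G ≃ᵐ GaugeConfig d L G) U = U.negReflect :=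
    fun U => rfl
  have hrefl : ∀ (m : ZMod L) (U : GaugeConfig d L G),
      tObs ρ x i j m (WilsonSiteRP.negReflectEquiv U) = tObs ρ x i j (-m) U := by
    intro m U
    rw [happ]
    unfold tObs
    rw [plaquetteHolonomy_negReflect_spatial U _ hi hj, negReflect_add_single hx]
  have hI : ∀ m m' : ZMod L,
      ∫ U, (tObs ρ x i j m U - c) * (tObs ρ x i j m' (WilsonSiteRP.negReflectEquiv U) - c)
          ∂(wilsonMeasure ρ β)
        = tCorr ρ β x i j (-m' - m) := by
    intro m m'
    simp_rw [hrefl]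
    rw [integral_centred_Pobs ρ hρ β x i j m (-m')]
  rw [hI, hI, hI] at key
  have e1 : -((s : ℕ) : ZMod L) - ((t : ℕ) : ZMod L) = -(((s + t : ℕ) : ZMod L)) := by
    push_cast; ring
  have e2 : -((t : ℕ) : ZMod L) - ((t : ℕ) : ZMod L) = -(((2 * t : ℕ) : ZMod L)) := by
    push_cast; ring
  have e3 : -((s : ℕ) : ZMod L) - ((s : ℕ) : ZMod L) = -(((2 * s : ℕ) : ZMod L)) := by
    push_cast; ring
  rw [e1, e2, e3, corr_neg, corr_neg, corr_neg] at key
  exact key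

/-- **`g(1) ≥ 0` on every torus with `L ≥ 2`, `β ≥ 0`** (reflection positivity applied to the
centred plaquette next to the link hyperplane). -/
theorem corr_one_nonneg (hL2 : 2 ≤ L) (hρ : Continuous ρ) {β : ℝ} (hβ : 0 ≤ β) {x : Site d L}
    (hx : x 0 = 0) {i j : Fin d} (hi : i ≠ 0) (hj : j ≠ 0) :
    0 ≤ tCorr ρ β x i j 1 := by
  haveI := isProbabilityMeasure_wilsonMeasure (d := d) (L := L) ρ hρ β
  haveI : Fact (1 < L) := ⟨by omega⟩
  set c := wilsonExpectation ρ β (tObs ρ x i j 0) with hc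
  obtain ⟨hAm, hAb, hAdep⟩ := centred_Pobs_props ρ hρ x hi hj ((1 : ℕ) : ZMod L) c
  have hval : ∀ e : Edge d L, e.1 0 = (x + Pi.single (0 : Fin d) (((1 : ℕ) : ZMod L)) : Site d L) 0 →
      (e.1 0).val = 1 := by
    intro e he1
    rw [he1, add_single_apply_zero hx, ZMod.val_natCast, Nat.mod_eq_of_lt (by omega)]
  -- the positivity `0 ≤ ∫ A · A∘Θ`, on the even and on the odd torus
  have hpos : 0 ≤ ∫ U, (tObs ρ x i j ((1 : ℕ) : ZMod L) U - c)
      * (tObs ρ x i j ((1 : ℕ) : ZMod L) U.timeReflect - c) ∂(wilsonMeasure ρ β) := by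
    rcases Nat.even_or_odd L with hE | hO
    · refine integral_mul_timeReflect_nonneg ρ hE hρ hβ hAm hAb fun U V hUV => hAdep fun e he => ?_
      obtain ⟨he2, he1⟩ := he
      have hv := hval e he1
      have hv' : ((e.1.shift e.2) 0).val = 1 := by rw [shift_apply_zero_of_ne e.1 he2, hv]
      refine hUV e ?_
      show 1 ≤ (e.1 0).val ∧ (e.1 0).val ≤ L / 2 ∧ 1 ≤ ((e.1.shift e.2) 0).val ∧
        ((e.1.shift e.2) 0).val ≤ L / 2
      rw [hv, hv']
      exact ⟨le_rfl, by omega, le_rfl, by omega⟩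
    · have hL3 : 3 ≤ L := by obtain ⟨r, hr⟩ := hO; omega
      refine integral_mul_timeReflect_nonneg_odd ρ hO hL3 hρ hβ hAm hAb fun U V hUV =>
        hAdep fun e he => ?_
      obtain ⟨he2, he1⟩ := he
      have hv := hval e he1
      refine hUV e ?_
      rw [Finset.coe_union, Set.mem_union, Finset.mem_coe, Finset.mem_coe, WilsonOddRP.mem_oPosEdges,
        WilsonOddRP.mem_oSharedEdges]
      left
      show 1 ≤ (e.1 0).val ∧ (e.1 0).val ≤ L / 2
      rw [hv]; exact ⟨le_rfl, by omega⟩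
  have hts : ∀ (U : GaugeConfig d L G) (y : Site d L),
      plaquetteHolonomy U.timeReflect y i j = plaquetteHolonomy U y.timeReflect i j := fun U y => by
    simp only [plaquetteHolonomy, GaugeConfig.timeReflect, hi, hj, if_false,
      WilsonRP.timeReflect_shift_of_ne _ hi, WilsonRP.timeReflect_shift_of_ne _ hj]
  have hrefl : ∀ U : GaugeConfig d L G,
      tObs ρ x i j ((1 : ℕ) : ZMod L) U.timeReflect = tObs ρ x i j (1 - ((1 : ℕ) : ZMod L)) U := by
    intro U
    unfold tObs
    rw [hts U _, timeReflect_add_single hx]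
  simp_rw [hrefl] at hpos
  rw [integral_centred_Pobs ρ hρ β x i j] at hpos
  have e1 : (1 : ZMod L) - ((1 : ℕ) : ZMod L) - ((1 : ℕ) : ZMod L) = -1 := by push_cast; ring
  rwa [e1, corr_neg] at hpos

end RP

end Summit.Ventures.LatticeQCDFlow.Theory2.Clustering
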